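import Summits.SmoothPoincare4.SmoothPoincare4.Theses.RootDecompZ

/-!
# RootDecompZ — glue of the rev-1 split «FillingLadder» of `CrossSectionZHS`

Proves the glue item `CrossSectionZHSGlue` (stmt-SmoothPoincare4-31858, support, rank 204) of
route-SmoothPoincare4-RootDecompZ rev 1/2:
`MazurFilledZHS → TwoHandleFilledZHS → BeyondTwoHandlesZHS → CrossSectionZHS`
(stmt-SmoothPoincare4-31855 → 31856 → 31857 → 30638).

Pure logic (two instances of excluded middle on the two filling predicates): a homology-3-sphere cross-section
`Y ⊂ M` either bounds a Mazur-type contractible filling (→ `MazurFilledZHS`), or it does not but bounds a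
two-2-handle contractible filling (→ `TwoHandleFilledZHS`), or neither (→ `BeyondTwoHandlesZHS`).
Text kernel-checked in the lens certificate HOME/decomp-sp4-lens-3/v9/FillingLadderV9.lean ll.150–156 and in the
tribunal's scratch `Trib8.z_zhs_glue` (TRIB-SP4-ROOTDECOMP-8.md §Method); this file re-proves it against the route's
own declarations. Root decomposition cell decomp-sp4 (D-0178); 0 sorry. Nothing here proves `SmoothPoincare4`.
-/

set_option linter.dupNamespace false

namespace Summit.SmoothPoincare4.SmoothPoincare4.Theorems.RootDecompZCrossSectionZHSSplit

open Summit.SmoothPoincare4.SmoothPoincare4.Theses.RootDecompZ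

/-- Item stmt-SmoothPoincare4-31858: the three filling strata re-assemble the parent `CrossSectionZHS`. -/
theorem crossSectionZHSGlue_holds : CrossSectionZHSGlue := by
  intro hMazur hTwo hBeyond M _ _ _ _ _ e Y _ _ _ _ _ _ _ y f hf hc
  refine (Classical.em _).elim (fun h₁ => hMazur M e Y y f hf hc h₁) (fun h₁ => ?_)
  exact (Classical.em _).elim (fun h₂ => hTwo M e Y y f hf hc h₂ h₁) (fun h₂ => hBeyond M e Y y f hf hc h₂)

end Summit.SmoothPoincare4.SmoothPoincare4.Theorems.RootDecompZCrossSectionZHSSplit
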